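/-
Copyright: the b2b-balaban T⁴-continuum CRUX team, row NE7b OWNER lineage `t4-ne7b-p1` (gen 135). Project licence.
-/
import Summits.QuantumFields.BalabanUV.T4Continuum.Spine.NE7b.SupFineCellNextFactor

/-!
# NORMALISING BY THE TRUE VACUUM FACTOR `Z_0` — THE TRADE-OFF OF (377)∕(381) MADE EXPLICIT: (377) normalised the next single-block factor by the
# CRUDE stability constant `N_D` (stability letter with constant ONE, smallness `2η + (1 − N_D⁻¹)` polluted by the normaliser mismatch).  The
# other choice is the TRUE vacuum factor `Z_0 := Z_{ψ=0}(𝒜)` (a number with `‖Z_0 − 1‖ ≤ 2η`): for `ĝ_D(ψ) := Z_ψ(𝒜)∕Z_0 − 1`,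
#   `ĝ_D(0) = 0`,   `‖ĝ_D(ψ)‖ ≤ 4η∕(1 − 2η)` on the small region (PURE `O(η)`, no mismatch),   `‖1 + ĝ_D(ψ)‖ ≤ (N_D∕(1 − 2η))·e^{½κ₀⁺Q_D(ψ)}` for all `ψ`
# (stability constant `N_D∕(1−2η) ≥ 1` instead of one).  Either way ONE number per block per step is produced whose product over the scales must
# converge — `∏(1 + O(η_j + N_{D,j} − 1))`: the located (α4) requirement «`η_j` summable» is normalisation-independent.  Pure algebra of complex
# numbers, then the road's reading (row NE7b, node U5c; (377)∕(381) BY NAME; [folklore])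

Cell `pub-balaban`, sub-cell `t4`, spine estimate NE7b (`T4WeightBudget.RelWeightBound`; the cell's OWN estimate — NOT PRINTED in
[Bałaban 1983–89], NOT PROVED).  Crux-route work under `Spine/NE7b/` by the row OWNER (`t4-ne7b-p1` gen 135, file (382)) under FREEZE
(0)'s crux-prover clause, on this gen's SCOPING-d7 DECISION (3)∕(d7′)(2′)(a) (the vacuum-energy extraction, algebraic half); NOTHING of Bałaban's is
named as a Lean object, valued or asserted; no `T4Continuum/Support` leaf typed; no `def`, no notation; zero `sorry`.  Imports (BY NAME): the OWNER's
(381) `…SupFineCellNextFactor` (`norm_pertZ_shifted_sub_one_le_fineCell`; through it (377) `norm_pertZ_shifted_le_twoLetter`, `one_le_normaliser`,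
`one_le_S₂`, (289) `one_le_regulatorCost`); Mathlib's `norm_sub_norm_le`, `div_sub_one`, `norm_div`.

WHAT IS PROVED ([folklore]):
* §1 ALGEBRA: `one_sub_le_norm_of_near_one` (`‖z − 1‖ ≤ a` ⟹ `1 − a ≤ ‖z‖`), `ne_zero_of_near_one` (`a < 1` ⟹ `z ≠ 0`), **`norm_div_sub_one_le`**
  (`‖w − 1‖ ≤ b`, `‖z − 1‖ ≤ a < 1` ⟹ `‖w∕z − 1‖ ≤ (b + a)∕(1 − a)`), **`norm_div_le_of_near_one`** (`‖w‖ ≤ B` ⟹ `‖w∕z‖ ≤ B∕(1 − a)`),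
  `div_self_sub_one` (`ĝ(0) = 0`);
* §2 THE ROAD'S READING in the fine-cell format: **`vacuumNormalised_S`** (`‖Z_ψ(𝒜)∕Z_0(𝒜) − 1‖ ≤ 4η∕(1−2η)` on the per-fine-cell region, with
  `Z_0 := Z_{ψ=0}` — the zero field is in the region), **`vacuumNormalised_L1`** (`‖Z_ψ(𝒜)∕Z_0(𝒜)‖ ≤ (N_D∕(1−2η))·e^{½κ₀(1+τ⁻¹)Σ_{cells D}ψ²}` for
  every `ψ`); §3 toy.

HONEST (what this is NOT).  Algebra; the EXTENSIVE bookkeeping of the extracted numbers `log Z_0(𝒜_{p'})` over the blocks (the vacuum energy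
density, `O(η)` per block by the same expansion) and — the real (α4) content — the extraction of the QUADRATIC part and the contraction of `η_j` are
untouched; scalar skeleton ((A3), NC-NE7b-α UNRULED); nothing of Bałaban's asserted.  BY-NAME EFFECT ON THE WALL: NONE.  NE7b NOT PRINTED ∕ NOT
PROVED; spine PROVED 0∕9; rung (B)+1 — the programme's measures remain FINITE-torus statements; NOT the mass gap, NOT Clay.  HONEST DEPENDENCY:
continuum YM on T⁴ ⇐ BetaPertH ∧ nine spine estimates (0∕9 proved); BetaPertH ⇐ (D1) ∧ (D4) ∧ CAP+tail; G-an2-4 gates asym, D1 and NE2∕3∕4.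
-/

set_option autoImplicit false

noncomputable section

namespace Summit.QuantumFields.BalabanUV.T4Continuum.NE7b.SupVacuumNormalisation

open MeasureTheory ProbabilityTheory Matrix Real Finset
open scoped BigOperators
open Literature.Probability.LatticeModels
open Literature.Analysis.Matrix (HasFiniteRange)
open SupFineCellNextFactor (norm_pertZ_shifted_sub_one_le_fineCell)
open SupTwoLetterNextFactor (norm_pertZ_shifted_le_twoLetter one_le_normaliser one_le_S₂)
open SupRegulatedActivityBound (one_le_regulatorCost)

/-! ## §1. Algebra of the normalisation by a number near one -/

/-- `‖z − 1‖ ≤ a` ⟹ `1 − a ≤ ‖z‖`. [folklore] -/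
theorem one_sub_le_norm_of_near_one {z : ℂ} {a : ℝ} (h : ‖z - 1‖ ≤ a) : 1 - a ≤ ‖z‖ := by
  have h1 : ‖(1 : ℂ)‖ - ‖z‖ ≤ ‖1 - z‖ := norm_sub_norm_le 1 z
  rw [norm_one, norm_sub_rev] at h1
  linarith

/-- `‖z − 1‖ ≤ a < 1` ⟹ `z ≠ 0`. [folklore] -/
theorem ne_zero_of_near_one {z : ℂ} {a : ℝ} (h : ‖z - 1‖ ≤ a) (ha : a < 1) : z ≠ 0 := fun hz => by
  have h1 := one_sub_le_norm_of_near_one h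
  rw [hz, norm_zero] at h1
  linarith

/-- **NORMALISING BY A NUMBER NEAR ONE KEEPS SMALLNESS PURE**: `‖w − 1‖ ≤ b`, `‖z − 1‖ ≤ a < 1` ⟹ `‖w∕z − 1‖ ≤ (b + a)∕(1 − a)`. [folklore] -/
theorem norm_div_sub_one_le {w z : ℂ} {a b : ℝ} (hw : ‖w - 1‖ ≤ b) (hz : ‖z - 1‖ ≤ a) (ha : a < 1) :
    ‖w / z - 1‖ ≤ (b + a) / (1 - a) := by
  have hz0 : z ≠ 0 := ne_zero_of_near_one hz ha
  have hzn : 1 - a ≤ ‖z‖ := one_sub_le_norm_of_near_one hz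
  have h1a : 0 < 1 - a := by linarith
  have hwz : ‖w - z‖ ≤ b + a := by
    calc ‖w - z‖ = ‖(w - 1) - (z - 1)‖ := by ring_nf
      _ ≤ ‖w - 1‖ + ‖z - 1‖ := norm_sub_le _ _
      _ ≤ b + a := add_le_add hw hz
  rw [div_sub_one hz0, norm_div]
  calc ‖w - z‖ / ‖z‖ ≤ (b + a) / ‖z‖ := div_le_div_of_nonneg_right hwz (norm_nonneg _)
    _ ≤ (b + a) / (1 - a) := by
        refine div_le_div_of_nonneg_left ?_ h1a hzn
        linarith [norm_nonneg (w - 1), norm_nonneg (z - 1)]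

/-- **… AND DIVIDES THE STABILITY CONSTANT BY `1 − a`**: `‖w‖ ≤ B`, `0 ≤ B`, `‖z − 1‖ ≤ a < 1` ⟹ `‖w∕z‖ ≤ B∕(1 − a)`. [folklore] -/
theorem norm_div_le_of_near_one {w z : ℂ} {a B : ℝ} (hw : ‖w‖ ≤ B) (hB : 0 ≤ B) (hz : ‖z - 1‖ ≤ a) (ha : a < 1) :
    ‖w / z‖ ≤ B / (1 - a) := by
  have hzn : 1 - a ≤ ‖z‖ := one_sub_le_norm_of_near_one hz
  have h1a : 0 < 1 - a := by linarith
  rw [norm_div]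
  calc ‖w‖ / ‖z‖ ≤ B / ‖z‖ := div_le_div_of_nonneg_right hw (norm_nonneg _)
    _ ≤ B / (1 - a) := div_le_div_of_nonneg_left hB h1a hzn

/-- `ĝ(0) = 0`: `z ≠ 0` ⟹ `z∕z − 1 = 0`. [folklore] -/
theorem div_self_sub_one {z : ℂ} (hz : z ≠ 0) : z / z - 1 = 0 := by rw [div_self hz, sub_self]

/-! ## §2. The road's reading: the `Z_0`-normalised next factor in the fine-cell format -/

section Road

variable {V : Type*} [DecidableEq V] {R : V → V → Prop} [DecidableRel R] {nbr : V → Finset V} {Δ : ℕ}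
variable {ι : Type} [Fintype ι] [DecidableEq ι]

/-- **(S⁺, vacuum-normalised) PURE `O(η)` SMALLNESS**: under the hypotheses of (381)'s `norm_pertZ_shifted_sub_one_le_fineCell` for the field `ψ`
(and hence for the zero field, which is small on every cell), with `Z_0 := Z_{ψ=0}(𝒜)`: `‖Z_ψ(𝒜)∕Z_0 − 1‖ ≤ (2η + 2η)∕(1 − 2η)`. [folklore] -/
theorem vacuumNormalised_S {Γ : Matrix ι ι ℝ} {γop γ₂ γ : ℝ} (hΓ : Γ.PosSemidef)
    (hΓop : (γop • (1 : Matrix ι ι ℝ) - Γ).PosSemidef) (hdiag : ∀ x, Γ x x ≤ γ) (hγ : 0 ≤ γ) {dι : ι → ι → ℕ} {ρ : ℕ}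
    (hfr : HasFiniteRange dι ρ Γ) (cell : V → Finset ι) (hdisj : ∀ p q, p ≠ q → Disjoint (cell p) (cell q)) {v : ℕ}
    (hv : ∀ p, (cell p).card ≤ v) (fine : V → Finset (Finset ι)) (hfine : ∀ p, ∀ c ∈ fine p, c ⊆ cell p) {v₀ : ℕ}
    (hv₀ : ∀ p, ∀ c ∈ fine p, c.card ≤ v₀) {m : ℕ} (hm : ∀ p, (fine p).card ≤ m)
    (hloc : ∀ (S : Finset V) (c : ∀ p ∈ S, Finset ι), (∀ p (hp : p ∈ S), c p hp ∈ fine p) →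
      (γ₂ • (1 : Matrix (S.attach.biUnion fun p => c p.1 p.2) (S.attach.biUnion fun p => c p.1 p.2) ℝ) -
        Γ.submatrix (fun e : (S.attach.biUnion fun p => c p.1 p.2) => (e : ι))
          (fun e : (S.attach.biUnion fun p => c p.1 p.2) => (e : ι))).PosSemidef)
    (hRsymm : ∀ x y, R x y → R y x) (hR : ∀ (p p' : V) (x y : ι), x ∈ cell p → y ∈ cell p' → dι x y ≤ ρ → p = p' ∨ R p p')
    (hΔ : ∀ x, (nbr x).card ≤ Δ) (hnbr : ∀ x y, R x y → y ∈ nbr x)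
    {f : Finset V → EuclideanSpace ℝ ι → ℂ} {ε κ₀ κ₂ τ θ h Ψ ΨP : ℝ} (hε : 0 < ε) (hκ₀ : 0 ≤ κ₀) (hκ₂ : 0 ≤ κ₂) (hτ : 0 < τ)
    (hθ0 : 0 < θ) (hθ1 : θ < 1) (h1 : 2 * (κ₀ * (1 + τ)) * γop ≤ θ) (h2 : 2 * κ₂ * γ₂ ≤ θ)
    (𝒜 : Finset (Finset V)) (hconn : ∀ X ∈ 𝒜, IsRConnected R X)
    (hmeas : ∀ X ∈ 𝒜, Measurable[⨆ p ∈ X, MeasurableSpace.comap (fun (ω : EuclideanSpace ℝ ι) (x : cell p) => ω x) inferInstance] (f X))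
    (hS : ∀ X ∈ 𝒜, X.card = 1 → ∀ ζ : EuclideanSpace ℝ ι, (∀ c ∈ X.biUnion fine, ∑ x ∈ c, ζ x ^ 2 ≤ h ^ 2) → ‖f X ζ‖ ≤ ε)
    (hL1 : ∀ X ∈ 𝒜, X.card = 1 → ∀ ζ : EuclideanSpace ℝ ι, ‖1 + f X ζ‖ ≤ exp (κ₀ * (∑ x ∈ X.biUnion cell, ζ x ^ 2) / 2))
    (hsup : ∀ X ∈ 𝒜, X.card ≠ 1 → ∀ ζ : EuclideanSpace ℝ ι, ‖f X ζ‖ ≤ ε ^ X.card) (ψ : EuclideanSpace ℝ ι) (hΨ0 : 0 ≤ Ψ) (hΨh : Ψ ≤ h)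
    (hψ : ∀ X ∈ 𝒜, X.card = 1 → ∀ c ∈ X.biUnion fine, ∑ x ∈ c, ψ x ^ 2 ≤ Ψ ^ 2)
    (hψP : ∀ X ∈ 𝒜, X.card = 1 → ∑ x ∈ X.biUnion cell, ψ x ^ 2 ≤ ΨP ^ 2)
    (hsmall : Real.exp 1 * (2 * Real.exp 1 * ((Δ : ℝ) + 1) ^ 2 *
      (ε + m * (2 * exp (κ₀ * (1 + τ⁻¹) * ΨP ^ 2 / 2)) * exp (-(κ₂ * (h - Ψ) ^ 2 / 2)) *
        (((1 - θ) ^ (-(2 * (κ₀ * (1 + τ)) * γ / (2 * θ)))) ^ v * ((1 - θ) ^ (-(2 * κ₂ * γ / (2 * θ)))) ^ v₀))) *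
      ((Δ : ℝ) + 1) ^ 2 ≤ 1 / 2)
    (hη : (𝒜.biUnion id).card * ((Δ : ℝ) + 1) * (2 * (Real.exp 1 * (2 * Real.exp 1 * ((Δ : ℝ) + 1) ^ 2 *
      (ε + m * (2 * exp (κ₀ * (1 + τ⁻¹) * ΨP ^ 2 / 2)) * exp (-(κ₂ * (h - Ψ) ^ 2 / 2)) *
        (((1 - θ) ^ (-(2 * (κ₀ * (1 + τ)) * γ / (2 * θ)))) ^ v * ((1 - θ) ^ (-(2 * κ₂ * γ / (2 * θ)))) ^ v₀))))) ≤ 1 / 2)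
    (hη1 : 2 * ((𝒜.biUnion id).card * ((Δ : ℝ) + 1) * (2 * (Real.exp 1 * (2 * Real.exp 1 * ((Δ : ℝ) + 1) ^ 2 *
      (ε + m * (2 * exp (κ₀ * (1 + τ⁻¹) * ΨP ^ 2 / 2)) * exp (-(κ₂ * (h - Ψ) ^ 2 / 2)) *
        (((1 - θ) ^ (-(2 * (κ₀ * (1 + τ)) * γ / (2 * θ)))) ^ v * ((1 - θ) ^ (-(2 * κ₂ * γ / (2 * θ)))) ^ v₀)))))) < 1) :
    ‖pertZ (multivariateGaussian 0 Γ) (fun X ω => f X (ω + ψ)) 𝒜 /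
          pertZ (multivariateGaussian 0 Γ) (fun X ω => f X (ω + 0)) 𝒜 - 1‖ ≤
      (2 * ((𝒜.biUnion id).card * ((Δ : ℝ) + 1) * (2 * (Real.exp 1 * (2 * Real.exp 1 * ((Δ : ℝ) + 1) ^ 2 *
        (ε + m * (2 * exp (κ₀ * (1 + τ⁻¹) * ΨP ^ 2 / 2)) * exp (-(κ₂ * (h - Ψ) ^ 2 / 2)) *
          (((1 - θ) ^ (-(2 * (κ₀ * (1 + τ)) * γ / (2 * θ)))) ^ v * ((1 - θ) ^ (-(2 * κ₂ * γ / (2 * θ)))) ^ v₀)))))) +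
       2 * ((𝒜.biUnion id).card * ((Δ : ℝ) + 1) * (2 * (Real.exp 1 * (2 * Real.exp 1 * ((Δ : ℝ) + 1) ^ 2 *
        (ε + m * (2 * exp (κ₀ * (1 + τ⁻¹) * ΨP ^ 2 / 2)) * exp (-(κ₂ * (h - Ψ) ^ 2 / 2)) *
          (((1 - θ) ^ (-(2 * (κ₀ * (1 + τ)) * γ / (2 * θ)))) ^ v * ((1 - θ) ^ (-(2 * κ₂ * γ / (2 * θ)))) ^ v₀))))))) /
      (1 - 2 * ((𝒜.biUnion id).card * ((Δ : ℝ) + 1) * (2 * (Real.exp 1 * (2 * Real.exp 1 * ((Δ : ℝ) + 1) ^ 2 *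
        (ε + m * (2 * exp (κ₀ * (1 + τ⁻¹) * ΨP ^ 2 / 2)) * exp (-(κ₂ * (h - Ψ) ^ 2 / 2)) *
          (((1 - θ) ^ (-(2 * (κ₀ * (1 + τ)) * γ / (2 * θ)))) ^ v * ((1 - θ) ^ (-(2 * κ₂ * γ / (2 * θ)))) ^ v₀))))))) := by
  -- the zero field is small on every fine cell and on every cell (with the same radii)
  have hψ0 : ∀ X ∈ 𝒜, X.card = 1 → ∀ c ∈ X.biUnion fine, ∑ x ∈ c, (0 : EuclideanSpace ℝ ι) x ^ 2 ≤ Ψ ^ 2 := by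
    intro X _ _ c _; simp; positivity
  have hψP0 : ∀ X ∈ 𝒜, X.card = 1 → ∑ x ∈ X.biUnion cell, (0 : EuclideanSpace ℝ ι) x ^ 2 ≤ ΨP ^ 2 := by
    intro X _ _; simp; positivity
  have hZψ := norm_pertZ_shifted_sub_one_le_fineCell hΓ hΓop hdiag hγ hfr cell hdisj hv fine hfine hv₀ hm hloc hRsymm hR hΔ hnbr hε hκ₀ hκ₂ hτ
    hθ0 hθ1 h1 h2 𝒜 hconn hmeas hS hL1 hsup ψ hΨ0 hΨh hψ hψP hsmall hη
  have hZ0 := norm_pertZ_shifted_sub_one_le_fineCell hΓ hΓop hdiag hγ hfr cell hdisj hv fine hfine hv₀ hm hloc hRsymm hR hΔ hnbr hε hκ₀ hκ₂ hτ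
    hθ0 hθ1 h1 h2 𝒜 hconn hmeas hS hL1 hsup 0 hΨ0 hΨh hψ0 hψP0 hsmall hη
  exact norm_div_sub_one_le hZψ hZ0 hη1

/-- **(L1⁺, vacuum-normalised) STABILITY WITH CONSTANT `N_D∕(1−2η)`**: under the hypotheses of (377)'s `norm_pertZ_shifted_le_twoLetter` (members
inside `D`, (L1), sup letters, the stability margin `θ₀`) and `‖Z_0 − 1‖ ≤ a < 1` for the chosen normaliser `Z_0` (e.g. `Z_{ψ=0}(𝒜)` by (381)):
`‖Z_ψ(𝒜)∕Z_0‖ ≤ (S₂·A₀^{#cells D}∕(1 − a))·e^{½κ₀(1+τ⁻¹)Σ_{cells D}ψ²}` for EVERY `ψ`. [folklore] -/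
theorem vacuumNormalised_L1 {Γ : Matrix ι ι ℝ} {γop γ : ℝ} (hΓ : Γ.PosSemidef) (hΓop : (γop • (1 : Matrix ι ι ℝ) - Γ).PosSemidef)
    (hdiag : ∀ i, Γ i i ≤ γ) (hγ : 0 ≤ γ) (cell : V → Finset ι) (hdisj : ∀ p q, p ≠ q → Disjoint (cell p) (cell q))
    {f : Finset V → EuclideanSpace ℝ ι → ℂ} {ε κ₀ τ θ₀ : ℝ} (hε : 0 ≤ ε) (hκ₀ : 0 ≤ κ₀) (hτ : 0 < τ) (hθ0 : 0 < θ₀) (hθ1 : θ₀ < 1)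
    (hκθ : κ₀ * (1 + τ) * γop ≤ θ₀) (𝒜 : Finset (Finset V)) {D : Finset V} (h𝒜D : ∀ X ∈ 𝒜, X ⊆ D)
    (hL1 : ∀ X ∈ 𝒜, X.card = 1 → ∀ ζ : EuclideanSpace ℝ ι, ‖1 + f X ζ‖ ≤ exp (κ₀ * (∑ x ∈ X.biUnion cell, ζ x ^ 2) / 2))
    (hsup : ∀ X ∈ 𝒜, X.card ≠ 1 → ∀ ζ : EuclideanSpace ℝ ι, ‖f X ζ‖ ≤ ε ^ X.card) {Z₀ : ℂ} {a : ℝ} (hZ₀ : ‖Z₀ - 1‖ ≤ a) (ha : a < 1)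
    (ψ : EuclideanSpace ℝ ι) :
    ‖pertZ (multivariateGaussian 0 Γ) (fun X ω => f X (ω + ψ)) 𝒜 / Z₀‖ ≤
      ((∏ X ∈ 𝒜 with ¬ X.card = 1, (1 + ε ^ X.card)) * ((1 - θ₀) ^ (-(κ₀ * (1 + τ) * γ / (2 * θ₀)))) ^ (D.biUnion cell).card) /
        (1 - a) * exp (κ₀ * (1 + τ⁻¹) * (∑ x ∈ D.biUnion cell, ψ x ^ 2) / 2) := by
  have h := norm_pertZ_shifted_le_twoLetter hΓ hΓop hdiag hγ cell hdisj hε hκ₀ hτ hθ0 hθ1 hκθ 𝒜 h𝒜D hL1 hsup ψ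
  have hB : 0 ≤ (∏ X ∈ 𝒜 with ¬ X.card = 1, (1 + ε ^ X.card)) * ((1 - θ₀) ^ (-(κ₀ * (1 + τ) * γ / (2 * θ₀)))) ^ (D.biUnion cell).card *
      exp (κ₀ * (1 + τ⁻¹) * (∑ x ∈ D.biUnion cell, ψ x ^ 2) / 2) := by
    have hκγ : 0 ≤ κ₀ * (1 + τ) * γ := by positivity
    have h1 : 1 ≤ (∏ X ∈ 𝒜 with ¬ X.card = 1, (1 + ε ^ X.card)) * ((1 - θ₀) ^ (-(κ₀ * (1 + τ) * γ / (2 * θ₀)))) ^ (D.biUnion cell).card :=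
      one_le_normaliser (one_le_S₂ hε 𝒜) (one_le_regulatorCost hκγ hθ0 hθ1)
    exact mul_nonneg (zero_le_one.trans h1) (exp_pos _).le
  have h2 := norm_div_le_of_near_one h hB hZ₀ ha
  rw [mul_div_right_comm] at h2
  exact h2

end Road

/-! ## §3. Toy -/

/-- Toy (§1): normalising `w = 1` by `z = 1` gives `ĝ = 0`, within the bound `(0 + 0)∕(1 − 0) = 0`. -/
example : ‖(1 : ℂ) / 1 - 1‖ ≤ (0 + 0) / (1 - 0) :=
  norm_div_sub_one_le (by simp) (by simp) zero_lt_one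

end Summit.QuantumFields.BalabanUV.T4Continuum.NE7b.SupVacuumNormalisation
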